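/-
Copyright (c) 2026 the pub-hodgecm-mathlib formalisation cell (harness21).  Prover seat hodgecm-mathlib-K2E3-p23 (g6), HCML Track B «K2-LIT» ∕ h413
(`stmt-HodgeConjecture-24833`), line `K2_E3_EllipticInputs`, leaf (nsc-S-A′) `sig_K2E3GL3PrincipalBlockStandardSpan`, road «EXP», case brick C1 of the architect's
`MEMO-SA-architecture.v2.K2E3-p25-g2.md` §3, FILE 3 of C1: the trace identities and the PAYER of the hosted case socket (S-A′-C1) `sig_K2E3GL3SAprimeC1` (U12 ED. 30 :512,
dealer K2E3-plan (g4); letters = K2E3-p03 (g6) D98 R0 11:43:41Z).  2026-09-04.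
-/
import Summits.HodgeConjecture.HodgeConjecture.Theorems.K2E3GL3OneLinkGenericStructure   -- ★ C1 file 2 (this seat): uniqueness, irreducibility, identification, `smoothTrace_quotient_eq_sub`
import Summits.HodgeConjecture.HodgeConjecture.Theorems.K2E3GL2UnlinkedIrreducible        -- ★ GL2-UNL (K2E3-p11 g7): `isIrreducible_parabolicIndGL_two_of_not_linked`, `coe_unramifiedTwist_one`
import Summits.HodgeConjecture.HodgeConjecture.Theorems.K2E3GL3CubeStandardModules        -- ★ C2 (K2E3-p11 g7): `nuHalf_mul_nuHalf`, `mul_nuHalf_mul_nuHalf_inv`, `mul_nuHalf_mul_nuHalf`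
import Literature.NumberTheory.Automorphic.SmoothInductionParabolicNontrivial              -- ★ `nontrivial_parabolicIndGL` (`D ≠ 0`)
import HarnessLib

/-!
# Crux `H413` — leaf (nsc-S-A′), road «EXP», case C1 «ONE LINK, GENERIC THIRD LETTER», file 3: the TRACE IDENTITIES `tr r₀ = tr D` ∕ `tr r₀ = tr (I θ) − tr D` and the
# payer `sAprimeC1` of the hosted case socket (S-A′-C1)

Cell `hodgecm-mathlib`, Track B; THEOREMS ONLY; count-neutral helper (`--supports stmt-HodgeConjecture-24833 --as helper`).  Setting = ★ C1 files 1–2 (abstract letters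
`x y z`, `θ = ![x,y,z]` regular, `z` unlinked to both neighbours, `h3cell`) + ★ STD-EMB's standard module `D η₀ ψ₀ = parabolicIndGL F ![false,false,true] (𝟙.twist ψ_Q)` with an
injective, non-surjective `Φ : D η₀ ψ₀ → I ![x,y,z]` (so `N = range Φ` is THE proper non-zero subrepresentation, `≅ D η₀ ψ₀`).
* §1 `ν`-bookkeeping: `self_ne_mul_nu` (`x ≠ x·ν`), `theta_vec_eq` (`![ην½·ν½⁻¹, ην½·ν½, ψ] = ![η, η·ν, ψ]`, over ★ C2 `mul_nuHalf_mul_nuHalf_inv` ∕ `mul_nuHalf_mul_nuHalf`).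
* §2 TRACES (abstract): **`smoothTrace_eq_of_classA`** — an irreducible smooth `r₀` with `r_B r₀` finite-dimensional and a class_A weight has `tr r₀ = tr (D η₀ ψ₀)`;
  **`smoothTrace_eq_of_classB`** — with a class_B weight, `tr r₀ = tr (I ![x,y,z]) − tr (D η₀ ψ₀)` (★ file 2 identification + `smoothTrace_quotient_eq_sub` + ★ `smoothTrace_eq_of_equiv`).
* §3 **`sAprimeC1`** — THE PAYER: statement = the socket (S-A′-C1) `sig_K2E3GL3SAprimeC1` (U12 ED. 30 :512) with ONE extra leading binder `hcell` = the socket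
  `sig_K2E3GL3PrincipalSeriesThreeCell F` ∀-closed over `χ` (the dealer's tie is `fun F _ _ _ _ _ => sAprimeC1 (sig_K2E3GL3PrincipalSeriesThreeCell F)`, exactly as for (S-A′-C0)).
  Proof: letters `x := θ i`, `y := θ j = θ i·ν`, `z := θ k`; regularity from the four `≠` hypotheses and `self_ne_mul_nu`; `u₁–u₄` by ★ GL2-UNL from the same `≠` facts
  (continuity by `MonoidHom.continuous_of_isOpen_ker`); `D (θ i·ν½) (θ k) ↪ I ![x,y,z]` by ★ STD-EMB (vector identity `theta_vec_eq`); `r_B r₀` finite-dimensional through `φ`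
  (★ `jacquetGLMap_injective` + ★ H0-a); `tch θ` is a weight of `r₀` (★ EMB converse on `φ ≠ 0`) and is the class_A resp. class_B weight of `![x,y,z]` according to the
  position pattern `(i,j,k)` (six cases); §2 gives the trace, packaged as the leaf's RHS with `(n₁,n₂,n₃) = (0,1,0)`, `b = 1` resp. `(1,1,0)`, `a = 1`, `b = −1`.
[BernsteinZelevinsky1977, §2.3, Cor. 2.13, Thm. 2.9]; [Zelevinsky1980, §4.2, Thm. 6.1, Ex. 3.2]; [Casselman1995, §6.3].
HONEST LABEL: HC_CM is proved only modulo the 7 printed citations (2 remaining named inputs: hLiu418 = stmt-HodgeConjecture-24832, h413 = stmt-HodgeConjecture-24833) until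
rung 0 closes; count-neutral helper; closes the hosted case socket (S-A′-C1) only when the dealer ties it, CONDITIONAL on the binder `hcell` (= the hosted socket
`sig_K2E3GL3PrincipalSeriesThreeCell`, E4b), stated not assumed as a fact.

## References
* [BernsteinZelevinsky1977] I. N. Bernstein, A. V. Zelevinsky, *Induced representations of reductive p-adic groups I*, Ann. Sci. ÉNS 10 (1977), §2.3, Cor. 2.13, Thm. 2.9.
* [Zelevinsky1980] A. V. Zelevinsky, *Induced representations of reductive p-adic groups II*, Ann. Sci. ÉNS 13 (1980), §4.2, Thm. 6.1, Ex. 3.2.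
* [Casselman1995] W. Casselman, *Introduction to the theory of admissible representations of p-adic reductive groups* (draft 1995), §6.3.
-/

set_option autoImplicit false
-- the mandated namespace repeats `HodgeConjecture.HodgeConjecture`, as in every `Theorems/*.lean` of this sub-problem
set_option linter.dupNamespace false

noncomputable section

open Representation Module Function Literature.NumberTheory.Automorphic Literature.NumberTheory.GaloisRepresentations.IsNonarchimedeanLocalField
open Literature.NumberTheory.GaloisRepresentations Literature.NumberTheory.Automorphic.Zelevinsky1980 Literature.RepresentationTheory.FiniteGroups
open MeasureTheory
open scoped MatrixGroups NNReal
open Summit.HodgeConjecture.HodgeConjecture.Cruxes.H413.K2E3GL3JacquetMultiplicityAdditive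
open Summit.HodgeConjecture.HodgeConjecture.Cruxes.H413.K2E3GL3PrincipalSeriesExponents (finrank_weightSpace_principalSeries_three_tch)
open Summit.HodgeConjecture.HodgeConjecture.Cruxes.H413.K2E3GL3EmbeddingOfWeight (finrank_weightSpace_ne_zero_of_intertwiningMap_ne_zero)
open Summit.HodgeConjecture.HodgeConjecture.Cruxes.H413.K2E3GL3StandardModuleEmbedding (isOpen_ker_tch isOpen_ker_psiQ isOpen_ker_mul_of_isOpen isOpen_ker_nuHalf
  coe_nuHalf_apply normAbs_cpow_half_mul_self exists_injective_not_surjective_intertwiningMap)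
open Summit.HodgeConjecture.HodgeConjecture.Cruxes.H413.K2E3GL3InductionInStagesEmbedding (monotone_twoOne)
open Summit.HodgeConjecture.HodgeConjecture.Cruxes.H413.K2E3GL2UnlinkedIrreducible (isIrreducible_parabolicIndGL_two_of_not_linked coe_unramifiedTwist_one)
open Summit.HodgeConjecture.HodgeConjecture.Cruxes.H413.K2E3GL3CubeStandardModules (mul_nuHalf_mul_nuHalf_inv mul_nuHalf_mul_nuHalf)
open Summit.HodgeConjecture.HodgeConjecture.Cruxes.H413.K2E3GL3PrincipalSeriesRegular
open Summit.HodgeConjecture.HodgeConjecture.Cruxes.H413.K2E3GL3OneLinkGeneric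
open Summit.HodgeConjecture.HodgeConjecture.Cruxes.H413.K2E3GL3OneLinkGenericStructure

namespace Summit.HodgeConjecture.HodgeConjecture.Cruxes.H413.K2E3GL3OneLinkGenericStandardSpan

variable {F : Type} [Field F] [ValuativeRel F] [TopologicalSpace F] [IsNonarchimedeanLocalField F]

/-! ## §1 `ν`-bookkeeping -/

/-- **`x ≠ x·ν`** (`ν(ϖ) = ‖ϖ‖ < 1`). [cite: Zelevinsky1980, §4.2] -/
theorem self_ne_mul_nu (x : Fˣ →* ℂˣ) : x ≠ x * ((unramifiedTwist F 1 : QuasiChar F).toMonoidHom) := by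
  intro h
  obtain ⟨ϖ, hϖ0, hϖ1⟩ := exists_valuation_pos_lt_one (F := F)
  have hϖ : (ϖ : F) ≠ 0 := (Valuation.ne_zero_iff _).1 hϖ0
  have hu := congrArg (fun χ : Fˣ →* ℂˣ => ((χ (Units.mk0 ϖ hϖ) : ℂˣ) : ℂ)) h
  simp only [MonoidHom.mul_apply, Units.val_mul, coe_unramifiedTwist_one, Units.val_mk0] at hu
  have hne : ((x (Units.mk0 ϖ hϖ) : ℂˣ) : ℂ) ≠ 0 := Units.ne_zero _
  have h1 : (((normAbs F ϖ : ℝ≥0) : ℝ) : ℂ) = 1 := mul_left_cancel₀ hne (hu.symm.trans (mul_one _).symm)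
  have hlt : ((normAbs F ϖ : ℝ≥0) : ℝ) < 1 := by exact_mod_cast (normAbs_lt_one_iff.2 hϖ1)
  have : ((normAbs F ϖ : ℝ≥0) : ℝ) = 1 := by exact_mod_cast h1
  exact absurd this hlt.ne

/-- **`![(ην½)ν½⁻¹, (ην½)ν½, ψ] = ![η, ην, ψ]`** — ★ STD-EMB's parametrisation read in the letters of the link `η — ην`. [cite: Zelevinsky1980, §4.2] -/
theorem theta_vec_eq (η ψ : Fˣ →* ℂˣ) :
    (![(η * ((unramifiedTwist F (1 / 2) : QuasiChar F).toMonoidHom)) * ((unramifiedTwist F (1 / 2) : QuasiChar F).toMonoidHom)⁻¹, (η * ((unramifiedTwist F (1 / 2) : QuasiChar F).toMonoidHom)) * ((unramifiedTwist F (1 / 2) : QuasiChar F).toMonoidHom), ψ] : Fin 3 → (Fˣ →* ℂˣ)) =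
      ![η, η * ((unramifiedTwist F 1 : QuasiChar F).toMonoidHom), ψ] := by
  rw [mul_nuHalf_mul_nuHalf_inv, mul_nuHalf_mul_nuHalf]

/-! ## §2 The trace of an irreducible with a weight in class_A ∕ class_B -/

section Traces

variable (x y z : Fˣ →* ℂˣ)

set_option maxHeartbeats 800000 in  -- identification bookkeeping (★ file 2)
/-- **class_A ⇒ `tr r₀ = tr (D η₀ ψ₀)`**: an irreducible smooth `r₀` with `r_B r₀` finite-dimensional and a class_A weight of `![x,y,z]` is `≅ range Φ ≅ D η₀ ψ₀` (★ file 2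
`nonempty_equiv_sub_of_classA`), and equivalent representations have equal characters (★ `smoothTrace_eq_of_equiv`). [cite: BernsteinZelevinsky1977, §2.3, Thm. 2.9] [cite: Zelevinsky1980, Thm. 6.1] -/
theorem smoothTrace_eq_of_classA (hx : IsOpen ((x.ker : Subgroup Fˣ) : Set Fˣ)) (hy : IsOpen ((y.ker : Subgroup Fˣ) : Set Fˣ))
    (hz : IsOpen ((z.ker : Subgroup Fˣ) : Set Fˣ)) (hinj : Function.Injective (![x, y, z] : Fin 3 → (Fˣ →* ℂˣ)))
    (u₁ : (parabolicIndGL F (lastBlockLabel 2) ((Representation.trivial ℂ (Π a : Bool, GL {i : Fin 2 // lastBlockLabel 2 i = a} F) ℂ).twist (maxParabolicLeviChar F 2 (y) (z)))).IsIrreducible)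
    (u₂ : (parabolicIndGL F (lastBlockLabel 2) ((Representation.trivial ℂ (Π a : Bool, GL {i : Fin 2 // lastBlockLabel 2 i = a} F) ℂ).twist (maxParabolicLeviChar F 2 (z) (y)))).IsIrreducible)
    (u₃ : (parabolicIndGL F (lastBlockLabel 2) ((Representation.trivial ℂ (Π a : Bool, GL {i : Fin 2 // lastBlockLabel 2 i = a} F) ℂ).twist (maxParabolicLeviChar F 2 (x) (z)))).IsIrreducible)
    (u₄ : (parabolicIndGL F (lastBlockLabel 2) ((Representation.trivial ℂ (Π a : Bool, GL {i : Fin 2 // lastBlockLabel 2 i = a} F) ℂ).twist (maxParabolicLeviChar F 2 (z) (x)))).IsIrreducible)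
    (h3cell : ∀ c : Fin 3 → Fin 2, Monotone c → Function.Surjective c →
      ∀ (W : Type) [AddCommGroup W] [Module ℂ W] (σ : Representation ℂ (Π a : Fin 2, GL {i : Fin 3 // c i = a} F) W),
        σ.IsIrreducible → σ.IsSmooth → σ.IsSupercuspidal →
        ∀ (N : Subrepresentation (jacquetGL F c (parabolicIndGL F (id : Fin 3 → Fin 3) ((Representation.trivial ℂ (Π a : Fin 3, GL {i : Fin 3 // (id : Fin 3 → Fin 3) i = a} F) ℂ).twist (∏ a : Fin 3, (((![x, y, z] : Fin 3 → (Fˣ →* ℂˣ))) a).comp (Matrix.GeneralLinearGroup.det.comp (Pi.evalMonoidHom (fun a : Fin 3 => GL {i : Fin 3 // (id : Fin 3 → Fin 3) i = a} F) a)))))))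
          (q : N.toRepresentation.IntertwiningMap σ), q = 0)
    (η₀ ψ₀ : Fˣ →* ℂˣ) (hη₀ : IsOpen ((η₀.ker : Subgroup Fˣ) : Set Fˣ)) (hψ₀ : IsOpen ((ψ₀.ker : Subgroup Fˣ) : Set Fˣ))
    (Φ : (parabolicIndGL F (![false, false, true] : Fin 3 → Bool) ((Representation.trivial ℂ (Π a : Bool, GL {i : Fin 3 // (![false, false, true] : Fin 3 → Bool) i = a} F) ℂ).twist ((η₀.comp (Matrix.GeneralLinearGroup.det.comp (Pi.evalMonoidHom (fun a : Bool => GL {i : Fin 3 // (![false, false, true] : Fin 3 → Bool) i = a} F) false))) * (ψ₀.comp (Matrix.GeneralLinearGroup.det.comp (Pi.evalMonoidHom (fun a : Bool => GL {i : Fin 3 // (![false, false, true] : Fin 3 → Bool) i = a} F) true)))))).IntertwiningMap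
      (parabolicIndGL F (id : Fin 3 → Fin 3) ((Representation.trivial ℂ (Π a : Fin 3, GL {i : Fin 3 // (id : Fin 3 → Fin 3) i = a} F) ℂ).twist (∏ a : Fin 3, (((![x, y, z] : Fin 3 → (Fˣ →* ℂˣ))) a).comp (Matrix.GeneralLinearGroup.det.comp (Pi.evalMonoidHom (fun a : Fin 3 => GL {i : Fin 3 // (id : Fin 3 → Fin 3) i = a} F) a))))))
    (hΦ : Function.Injective Φ) (hΦ' : ¬ Function.Surjective Φ)
    (r₀ : SmoothIrrep (GL (Fin 3) F)) [FiniteDimensional ℂ (restrictUnipotentGL F (id : Fin 3 → Fin 3) r₀.ρ).Coinvariants]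
    (hw : finrank ℂ ↥(⨅ m, Module.End.maxGenEigenspace (normalizedJacquetGL F (id : Fin 3 → Fin 3) r₀.ρ m) (((∏ a : Fin 3, (((![x, y, z] : Fin 3 → (Fˣ →* ℂˣ))) a).comp (Matrix.GeneralLinearGroup.det.comp (Pi.evalMonoidHom (fun a : Fin 3 => GL {i : Fin 3 // (id : Fin 3 → Fin 3) i = a} F) a))) m : ℂˣ) : ℂ)) ≠ 0 ∨
      finrank ℂ ↥(⨅ m, Module.End.maxGenEigenspace (normalizedJacquetGL F (id : Fin 3 → Fin 3) r₀.ρ m) (((∏ a : Fin 3, (((![x, z, y] : Fin 3 → (Fˣ →* ℂˣ))) a).comp (Matrix.GeneralLinearGroup.det.comp (Pi.evalMonoidHom (fun a : Fin 3 => GL {i : Fin 3 // (id : Fin 3 → Fin 3) i = a} F) a))) m : ℂˣ) : ℂ)) ≠ 0 ∨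
      finrank ℂ ↥(⨅ m, Module.End.maxGenEigenspace (normalizedJacquetGL F (id : Fin 3 → Fin 3) r₀.ρ m) (((∏ a : Fin 3, (((![z, x, y] : Fin 3 → (Fˣ →* ℂˣ))) a).comp (Matrix.GeneralLinearGroup.det.comp (Pi.evalMonoidHom (fun a : Fin 3 => GL {i : Fin 3 // (id : Fin 3 → Fin 3) i = a} F) a))) m : ℂˣ) : ℂ)) ≠ 0)
    [MeasurableSpace (GL (Fin 3) F)] [BorelSpace (GL (Fin 3) F)] (μ : Measure (GL (Fin 3) F)) [μ.IsHaarMeasure] (f : GL (Fin 3) F → ℂ) :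
    r₀.ρ.smoothTrace μ f = (parabolicIndGL F (![false, false, true] : Fin 3 → Bool) ((Representation.trivial ℂ (Π a : Bool, GL {i : Fin 3 // (![false, false, true] : Fin 3 → Bool) i = a} F) ℂ).twist ((η₀.comp (Matrix.GeneralLinearGroup.det.comp (Pi.evalMonoidHom (fun a : Bool => GL {i : Fin 3 // (![false, false, true] : Fin 3 → Bool) i = a} F) false))) * (ψ₀.comp (Matrix.GeneralLinearGroup.det.comp (Pi.evalMonoidHom (fun a : Bool => GL {i : Fin 3 // (![false, false, true] : Fin 3 → Bool) i = a} F) true)))))).smoothTrace μ f := by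
  haveI := nontrivial_parabolicIndGL F (![false, false, true] : Fin 3 → Bool) monotone_twoOne
    ((Representation.trivial ℂ (Π a : Bool, GL {i : Fin 3 // (![false, false, true] : Fin 3 → Bool) i = a} F) ℂ).twist ((η₀.comp (Matrix.GeneralLinearGroup.det.comp (Pi.evalMonoidHom (fun a : Bool => GL {i : Fin 3 // (![false, false, true] : Fin 3 → Bool) i = a} F) false))) * (ψ₀.comp (Matrix.GeneralLinearGroup.det.comp (Pi.evalMonoidHom (fun a : Bool => GL {i : Fin 3 // (![false, false, true] : Fin 3 → Bool) i = a} F) true)))))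
    (isSmooth_trivial_twist (isOpen_ker_psiQ η₀ ψ₀ hη₀ hψ₀))
  have hN0 : Φ.range ≠ ⊥ := by
    intro h0
    obtain ⟨d, hd⟩ := exists_ne (0 : (Representation.SmoothInd (standardParabolicGL F (![false, false, true] : Fin 3 → Bool)) (Representation.twist (((Representation.trivial ℂ (Π a : Bool, GL {i : Fin 3 // (![false, false, true] : Fin 3 → Bool) i = a} F) ℂ).twist ((η₀.comp (Matrix.GeneralLinearGroup.det.comp (Pi.evalMonoidHom (fun a : Bool => GL {i : Fin 3 // (![false, false, true] : Fin 3 → Bool) i = a} F) false))) * (ψ₀.comp (Matrix.GeneralLinearGroup.det.comp (Pi.evalMonoidHom (fun a : Bool => GL {i : Fin 3 // (![false, false, true] : Fin 3 → Bool) i = a} F) true))))).comp (leviProjection F (![false, false, true] : Fin 3 → Bool))) (rootDeltaChar (standardParabolicGL F (![false, false, true] : Fin 3 → Bool))))))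
    have hmem : Φ d ∈ Φ.range := ⟨d, rfl⟩
    rw [h0] at hmem
    have h1 : Φ d = 0 := (Submodule.mem_bot ℂ).1 hmem
    exact hd (hΦ (h1.trans (map_zero Φ).symm))
  have hN1 : Φ.range ≠ ⊤ := fun ht => hΦ' fun w => by
    have hw' : w ∈ Φ.range := by rw [ht]; trivial
    exact hw'
  haveI : r₀.ρ.IsIrreducible := r₀.isIrreducible
  have hne := nonempty_equiv_sub_of_classA x y z r₀.ρ hx hy hz hinj u₁ u₂ u₃ u₄ h3cell Φ.range hN0 hN1 r₀.isSmooth hw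
  obtain ⟨e⟩ := hne
  have eD : (parabolicIndGL F (![false, false, true] : Fin 3 → Bool) ((Representation.trivial ℂ (Π a : Bool, GL {i : Fin 3 // (![false, false, true] : Fin 3 → Bool) i = a} F) ℂ).twist ((η₀.comp (Matrix.GeneralLinearGroup.det.comp (Pi.evalMonoidHom (fun a : Bool => GL {i : Fin 3 // (![false, false, true] : Fin 3 → Bool) i = a} F) false))) * (ψ₀.comp (Matrix.GeneralLinearGroup.det.comp (Pi.evalMonoidHom (fun a : Bool => GL {i : Fin 3 // (![false, false, true] : Fin 3 → Bool) i = a} F) true)))))).Equiv Φ.range.toRepresentation :=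
    Representation.Equiv.mk (LinearEquiv.ofInjective Φ.toLinearMap hΦ) fun g => LinearMap.ext fun v => Subtype.ext (by
      change Φ (_) = _
      exact Representation.IntertwiningMap.isIntertwining _ _ Φ g v)
  rw [← congrFun (Representation.smoothTrace_eq_of_equiv _ μ e) f, congrFun (Representation.smoothTrace_eq_of_equiv _ μ eD) f]

set_option maxHeartbeats 800000 in  -- identification bookkeeping (★ file 2)
/-- **class_B ⇒ `tr r₀ = tr (I ![x,y,z]) − tr (D η₀ ψ₀)`**: with a class_B weight, `r₀ ≅ I θ ⁄ range Φ` (★ file 2 `nonempty_equiv_quotient_of_classB`), whose character is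
`tr (I θ) − tr (range Φ) = tr (I θ) − tr (D η₀ ψ₀)` (★ file 2 `smoothTrace_quotient_eq_sub`, ★ `smoothTrace_eq_of_equiv`). [cite: BernsteinZelevinsky1977, §2.3, Thm. 2.9] [cite: Zelevinsky1980, Thm. 6.1] -/
theorem smoothTrace_eq_of_classB (hx : IsOpen ((x.ker : Subgroup Fˣ) : Set Fˣ)) (hy : IsOpen ((y.ker : Subgroup Fˣ) : Set Fˣ))
    (hz : IsOpen ((z.ker : Subgroup Fˣ) : Set Fˣ)) (hinj : Function.Injective (![x, y, z] : Fin 3 → (Fˣ →* ℂˣ)))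
    (u₁ : (parabolicIndGL F (lastBlockLabel 2) ((Representation.trivial ℂ (Π a : Bool, GL {i : Fin 2 // lastBlockLabel 2 i = a} F) ℂ).twist (maxParabolicLeviChar F 2 (y) (z)))).IsIrreducible)
    (u₂ : (parabolicIndGL F (lastBlockLabel 2) ((Representation.trivial ℂ (Π a : Bool, GL {i : Fin 2 // lastBlockLabel 2 i = a} F) ℂ).twist (maxParabolicLeviChar F 2 (z) (y)))).IsIrreducible)
    (u₃ : (parabolicIndGL F (lastBlockLabel 2) ((Representation.trivial ℂ (Π a : Bool, GL {i : Fin 2 // lastBlockLabel 2 i = a} F) ℂ).twist (maxParabolicLeviChar F 2 (x) (z)))).IsIrreducible)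
    (u₄ : (parabolicIndGL F (lastBlockLabel 2) ((Representation.trivial ℂ (Π a : Bool, GL {i : Fin 2 // lastBlockLabel 2 i = a} F) ℂ).twist (maxParabolicLeviChar F 2 (z) (x)))).IsIrreducible)
    (h3cell : ∀ c : Fin 3 → Fin 2, Monotone c → Function.Surjective c →
      ∀ (W : Type) [AddCommGroup W] [Module ℂ W] (σ : Representation ℂ (Π a : Fin 2, GL {i : Fin 3 // c i = a} F) W),
        σ.IsIrreducible → σ.IsSmooth → σ.IsSupercuspidal →
        ∀ (N : Subrepresentation (jacquetGL F c (parabolicIndGL F (id : Fin 3 → Fin 3) ((Representation.trivial ℂ (Π a : Fin 3, GL {i : Fin 3 // (id : Fin 3 → Fin 3) i = a} F) ℂ).twist (∏ a : Fin 3, (((![x, y, z] : Fin 3 → (Fˣ →* ℂˣ))) a).comp (Matrix.GeneralLinearGroup.det.comp (Pi.evalMonoidHom (fun a : Fin 3 => GL {i : Fin 3 // (id : Fin 3 → Fin 3) i = a} F) a)))))))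
          (q : N.toRepresentation.IntertwiningMap σ), q = 0)
    (η₀ ψ₀ : Fˣ →* ℂˣ) (hη₀ : IsOpen ((η₀.ker : Subgroup Fˣ) : Set Fˣ)) (hψ₀ : IsOpen ((ψ₀.ker : Subgroup Fˣ) : Set Fˣ))
    (Φ : (parabolicIndGL F (![false, false, true] : Fin 3 → Bool) ((Representation.trivial ℂ (Π a : Bool, GL {i : Fin 3 // (![false, false, true] : Fin 3 → Bool) i = a} F) ℂ).twist ((η₀.comp (Matrix.GeneralLinearGroup.det.comp (Pi.evalMonoidHom (fun a : Bool => GL {i : Fin 3 // (![false, false, true] : Fin 3 → Bool) i = a} F) false))) * (ψ₀.comp (Matrix.GeneralLinearGroup.det.comp (Pi.evalMonoidHom (fun a : Bool => GL {i : Fin 3 // (![false, false, true] : Fin 3 → Bool) i = a} F) true)))))).IntertwiningMap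
      (parabolicIndGL F (id : Fin 3 → Fin 3) ((Representation.trivial ℂ (Π a : Fin 3, GL {i : Fin 3 // (id : Fin 3 → Fin 3) i = a} F) ℂ).twist (∏ a : Fin 3, (((![x, y, z] : Fin 3 → (Fˣ →* ℂˣ))) a).comp (Matrix.GeneralLinearGroup.det.comp (Pi.evalMonoidHom (fun a : Fin 3 => GL {i : Fin 3 // (id : Fin 3 → Fin 3) i = a} F) a))))))
    (hΦ : Function.Injective Φ) (hΦ' : ¬ Function.Surjective Φ)
    (r₀ : SmoothIrrep (GL (Fin 3) F)) [FiniteDimensional ℂ (restrictUnipotentGL F (id : Fin 3 → Fin 3) r₀.ρ).Coinvariants]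
    (hw : finrank ℂ ↥(⨅ m, Module.End.maxGenEigenspace (normalizedJacquetGL F (id : Fin 3 → Fin 3) r₀.ρ m) (((∏ a : Fin 3, (((![y, x, z] : Fin 3 → (Fˣ →* ℂˣ))) a).comp (Matrix.GeneralLinearGroup.det.comp (Pi.evalMonoidHom (fun a : Fin 3 => GL {i : Fin 3 // (id : Fin 3 → Fin 3) i = a} F) a))) m : ℂˣ) : ℂ)) ≠ 0 ∨
      finrank ℂ ↥(⨅ m, Module.End.maxGenEigenspace (normalizedJacquetGL F (id : Fin 3 → Fin 3) r₀.ρ m) (((∏ a : Fin 3, (((![y, z, x] : Fin 3 → (Fˣ →* ℂˣ))) a).comp (Matrix.GeneralLinearGroup.det.comp (Pi.evalMonoidHom (fun a : Fin 3 => GL {i : Fin 3 // (id : Fin 3 → Fin 3) i = a} F) a))) m : ℂˣ) : ℂ)) ≠ 0 ∨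
      finrank ℂ ↥(⨅ m, Module.End.maxGenEigenspace (normalizedJacquetGL F (id : Fin 3 → Fin 3) r₀.ρ m) (((∏ a : Fin 3, (((![z, y, x] : Fin 3 → (Fˣ →* ℂˣ))) a).comp (Matrix.GeneralLinearGroup.det.comp (Pi.evalMonoidHom (fun a : Fin 3 => GL {i : Fin 3 // (id : Fin 3 → Fin 3) i = a} F) a))) m : ℂˣ) : ℂ)) ≠ 0)
    [MeasurableSpace (GL (Fin 3) F)] [BorelSpace (GL (Fin 3) F)] (μ : Measure (GL (Fin 3) F)) [μ.IsHaarMeasure] (f : GL (Fin 3) F → ℂ) :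
    r₀.ρ.smoothTrace μ f = (parabolicIndGL F (id : Fin 3 → Fin 3) ((Representation.trivial ℂ (Π a : Fin 3, GL {i : Fin 3 // (id : Fin 3 → Fin 3) i = a} F) ℂ).twist (∏ a : Fin 3, (((![x, y, z] : Fin 3 → (Fˣ →* ℂˣ))) a).comp (Matrix.GeneralLinearGroup.det.comp (Pi.evalMonoidHom (fun a : Fin 3 => GL {i : Fin 3 // (id : Fin 3 → Fin 3) i = a} F) a))))).smoothTrace μ f - (parabolicIndGL F (![false, false, true] : Fin 3 → Bool) ((Representation.trivial ℂ (Π a : Bool, GL {i : Fin 3 // (![false, false, true] : Fin 3 → Bool) i = a} F) ℂ).twist ((η₀.comp (Matrix.GeneralLinearGroup.det.comp (Pi.evalMonoidHom (fun a : Bool => GL {i : Fin 3 // (![false, false, true] : Fin 3 → Bool) i = a} F) false))) * (ψ₀.comp (Matrix.GeneralLinearGroup.det.comp (Pi.evalMonoidHom (fun a : Bool => GL {i : Fin 3 // (![false, false, true] : Fin 3 → Bool) i = a} F) true)))))).smoothTrace μ f := by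
  haveI := nontrivial_parabolicIndGL F (![false, false, true] : Fin 3 → Bool) monotone_twoOne
    ((Representation.trivial ℂ (Π a : Bool, GL {i : Fin 3 // (![false, false, true] : Fin 3 → Bool) i = a} F) ℂ).twist ((η₀.comp (Matrix.GeneralLinearGroup.det.comp (Pi.evalMonoidHom (fun a : Bool => GL {i : Fin 3 // (![false, false, true] : Fin 3 → Bool) i = a} F) false))) * (ψ₀.comp (Matrix.GeneralLinearGroup.det.comp (Pi.evalMonoidHom (fun a : Bool => GL {i : Fin 3 // (![false, false, true] : Fin 3 → Bool) i = a} F) true)))))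
    (isSmooth_trivial_twist (isOpen_ker_psiQ η₀ ψ₀ hη₀ hψ₀))
  have hN0 : Φ.range ≠ ⊥ := by
    intro h0
    obtain ⟨d, hd⟩ := exists_ne (0 : (Representation.SmoothInd (standardParabolicGL F (![false, false, true] : Fin 3 → Bool)) (Representation.twist (((Representation.trivial ℂ (Π a : Bool, GL {i : Fin 3 // (![false, false, true] : Fin 3 → Bool) i = a} F) ℂ).twist ((η₀.comp (Matrix.GeneralLinearGroup.det.comp (Pi.evalMonoidHom (fun a : Bool => GL {i : Fin 3 // (![false, false, true] : Fin 3 → Bool) i = a} F) false))) * (ψ₀.comp (Matrix.GeneralLinearGroup.det.comp (Pi.evalMonoidHom (fun a : Bool => GL {i : Fin 3 // (![false, false, true] : Fin 3 → Bool) i = a} F) true))))).comp (leviProjection F (![false, false, true] : Fin 3 → Bool))) (rootDeltaChar (standardParabolicGL F (![false, false, true] : Fin 3 → Bool))))))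
    have hmem : Φ d ∈ Φ.range := ⟨d, rfl⟩
    rw [h0] at hmem
    have h1 : Φ d = 0 := (Submodule.mem_bot ℂ).1 hmem
    exact hd (hΦ (h1.trans (map_zero Φ).symm))
  have hN1 : Φ.range ≠ ⊤ := fun ht => hΦ' fun w => by
    have hw' : w ∈ Φ.range := by rw [ht]; trivial
    exact hw'
  haveI : r₀.ρ.IsIrreducible := r₀.isIrreducible
  have hne := nonempty_equiv_quotient_of_classB x y z r₀.ρ hx hy hz hinj u₁ u₂ u₃ u₄ h3cell Φ.range hN0 hN1 r₀.isSmooth hw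
  obtain ⟨e⟩ := hne
  have eD : (parabolicIndGL F (![false, false, true] : Fin 3 → Bool) ((Representation.trivial ℂ (Π a : Bool, GL {i : Fin 3 // (![false, false, true] : Fin 3 → Bool) i = a} F) ℂ).twist ((η₀.comp (Matrix.GeneralLinearGroup.det.comp (Pi.evalMonoidHom (fun a : Bool => GL {i : Fin 3 // (![false, false, true] : Fin 3 → Bool) i = a} F) false))) * (ψ₀.comp (Matrix.GeneralLinearGroup.det.comp (Pi.evalMonoidHom (fun a : Bool => GL {i : Fin 3 // (![false, false, true] : Fin 3 → Bool) i = a} F) true)))))).Equiv Φ.range.toRepresentation :=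
    Representation.Equiv.mk (LinearEquiv.ofInjective Φ.toLinearMap hΦ) fun g => LinearMap.ext fun v => Subtype.ext (by
      change Φ (_) = _
      exact Representation.IntertwiningMap.isIntertwining _ _ Φ g v)
  rw [← congrFun (Representation.smoothTrace_eq_of_equiv _ μ e) f, smoothTrace_quotient_eq_sub x y z hx hy hz μ Φ.range f,
    congrFun (Representation.smoothTrace_eq_of_equiv _ μ eD) f]

end Traces

/-! ## §3 The payer of the hosted case socket (S-A′-C1) -/

set_option maxHeartbeats 1600000 in  -- 6 position patterns × the bookkeeping of files 1–2
/-- **(S-A′-C1) PAID: one link `θ j = θ i·ν`, generic third letter `θ k`.**  For an admissible irreducible smooth `r₀` embedded in the principal series `I θ`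
(`φ` injective), indices `i j k` pairwise distinct with `θ j = θ i·ν` and `θ k ∉ {θ i, θ j, θ j·ν, θ i·ν⁻¹}`, the distribution character of `r₀` is `tr D` (`D = D (θ i·ν½) (θ k)`,
the P₂₁-standard module) when the position pattern puts `tch θ` in class_A of `![θ i, θ j, θ k]`, and `tr (I ![θ i, θ j, θ k]) − tr D` when it puts it in class_B — the leaf's
RHS with `(n₁,n₂,n₃) = (0,1,0)`, `b = 1`, resp. `(1,1,0)`, `a = 1`, `b = −1`.  Statement = the hosted socket `sig_K2E3GL3SAprimeC1` (U12 ED. 30 :512) preceded by the ONE binder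
`hcell` (= `sig_K2E3GL3PrincipalSeriesThreeCell F`).  [cite: Zelevinsky1980, Thm. 6.1, Ex. 3.2] [cite: BernsteinZelevinsky1977, §2.3, Thm. 2.9] -/
theorem sAprimeC1 [CharZero F]
    (hcell : ∀ (χ : (Π a : Fin 3, GL {i : Fin 3 // (id : Fin 3 → Fin 3) i = a} F) →* ℂˣ), ∀ c : Fin 3 → Fin 2, Monotone c → Function.Surjective c →
      ∀ (W : Type) [AddCommGroup W] [Module ℂ W] (σ : Representation ℂ (Π a : Fin 2, GL {i : Fin 3 // c i = a} F) W),
        σ.IsIrreducible → σ.IsSmooth → σ.IsSupercuspidal →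
        ∀ (N : Subrepresentation (Representation.jacquetGL F c (Representation.parabolicIndGL F (id : Fin 3 → Fin 3)
            ((Representation.trivial ℂ (Π a : Fin 3, GL {i : Fin 3 // (id : Fin 3 → Fin 3) i = a} F) ℂ).twist χ))))
          (q : N.toRepresentation.IntertwiningMap σ), q = 0) :
    ∀ (r₀ : SmoothIrrep (GL (Fin 3) F)), r₀.ρ.IsAdmissible → ∀ (θ : Fin 3 → (Fˣ →* ℂˣ)), (∀ a, IsOpen (((θ a).ker : Subgroup Fˣ) : Set Fˣ)) →
      ∀ φ : r₀.ρ.IntertwiningMap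
          (Representation.parabolicIndGL F (id : Fin 3 → Fin 3) ((Representation.trivial ℂ (Π a : Fin 3, GL {i : Fin 3 // (id : Fin 3 → Fin 3) i = a} F) ℂ).twist (∏ a : Fin 3, (θ a).comp (Matrix.GeneralLinearGroup.det.comp (Pi.evalMonoidHom (fun a : Fin 3 => GL {i : Fin 3 // (id : Fin 3 → Fin 3) i = a} F) a))))),
        Function.Injective φ → ∀ i j k : Fin 3, i ≠ j → i ≠ k → j ≠ k → θ j = θ i * ((unramifiedTwist F 1 : QuasiChar F).toMonoidHom) →
    θ k ≠ θ i → θ k ≠ θ j → θ k ≠ θ j * ((unramifiedTwist F 1 : QuasiChar F).toMonoidHom) → θ k * ((unramifiedTwist F 1 : QuasiChar F).toMonoidHom) ≠ θ i →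
    ∃ (n₁ n₂ n₃ : ℕ) (a : Fin n₁ → ℤ) (χ : Fin n₁ → ((Π a : Fin 3, GL {i : Fin 3 // (id : Fin 3 → Fin 3) i = a} F) →* ℂˣ))
      (b : Fin n₂ → ℤ) (ψ : Fin n₂ → ((Π t : Bool, GL {i : Fin 3 // (![false, false, true] : Fin 3 → Bool) i = t} F) →* ℂˣ))
      (e : Fin n₃ → ℤ) (η : Fin n₃ → (GL (Fin 3) F →* ℂˣ)),
      (∀ i, IsOpen ((χ i).ker : Set (Π a : Fin 3, GL {i : Fin 3 // (id : Fin 3 → Fin 3) i = a} F))) ∧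
      (∀ j, IsOpen ((ψ j).ker : Set (Π t : Bool, GL {i : Fin 3 // (![false, false, true] : Fin 3 → Bool) i = t} F))) ∧
      (∀ k, IsOpen ((η k).ker : Set (GL (Fin 3) F))) ∧
      ∀ [MeasurableSpace (GL (Fin 3) F)] [BorelSpace (GL (Fin 3) F)] (μ : Measure (GL (Fin 3) F)) [μ.IsHaarMeasure]
        (f : GL (Fin 3) F → ℂ), f ∈ SchwartzBruhat (GL (Fin 3) F) →
        (IrrClass.mk r₀).smoothTrace μ f =
          (∑ i, (a i : ℂ) * (Representation.parabolicIndGL F (id : Fin 3 → Fin 3)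
              ((Representation.trivial ℂ (Π t : Fin 3, GL {i : Fin 3 // (id : Fin 3 → Fin 3) i = t} F) ℂ).twist (χ i))).smoothTrace μ f) +
          (∑ j, (b j : ℂ) * (Representation.parabolicIndGL F (![false, false, true] : Fin 3 → Bool)
              ((Representation.trivial ℂ (Π t : Bool, GL {i : Fin 3 // (![false, false, true] : Fin 3 → Bool) i = t} F) ℂ).twist (ψ j))).smoothTrace μ f) +
          (∑ k, (e k : ℂ) * ((Representation.trivial ℂ (GL (Fin 3) F) ℂ).twist (η k)).smoothTrace μ f) := by
  intro r₀ _ θ hθ φ hφ i j k hij hik hjk hl h1 h2 h3 h4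
  classical
  haveI : r₀.ρ.IsIrreducible := r₀.isIrreducible
  -- the letters `x = θ i`, `y = θ j = θ i·ν`, `z = θ k`; regularity and unlinkedness
  have hxy : θ i ≠ θ j := by rw [hl]; exact self_ne_mul_nu (θ i)
  have hinj : Function.Injective (![θ i, θ j, θ k] : Fin 3 → (Fˣ →* ℂˣ)) := by
    intro a b hab
    fin_cases a <;> fin_cases b
    all_goals first
      | rfl
      | (exfalso
         simp only [Matrix.cons_val_zero, Matrix.cons_val_one, Matrix.cons_val_two, Matrix.head_cons, Matrix.tail_cons, Fin.zero_eta, Fin.mk_one,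
           Fin.reduceFinMk] at hab
         first | exact hxy hab | exact hxy hab.symm | exact h1 hab | exact h1 hab.symm | exact h2 hab | exact h2 hab.symm)
  have hcont : ∀ a, Continuous fun t => (((θ a) t : ℂˣ) : ℂ) := fun a =>
    Units.continuous_val.comp (Literature.NumberTheory.Automorphic.MonoidHom.continuous_of_isOpen_ker (θ a) (hθ a))
  have hyz : θ j ≠ θ k * ((unramifiedTwist F 1 : QuasiChar F).toMonoidHom) := by
    rw [hl]; intro h; exact h1 (mul_right_cancel h).symm
  have hzx : θ i ≠ θ k * ((unramifiedTwist F 1 : QuasiChar F).toMonoidHom) := fun h => h4 h.symm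
  have hxz : θ k ≠ θ i * ((unramifiedTwist F 1 : QuasiChar F).toMonoidHom) := by rw [← hl]; exact h2
  have u₁ := isIrreducible_parabolicIndGL_two_of_not_linked (θ j) (θ k) (hcont j) (hcont k) h3 hyz
  have u₂ := isIrreducible_parabolicIndGL_two_of_not_linked (θ k) (θ j) (hcont k) (hcont j) hyz h3
  have u₃ := isIrreducible_parabolicIndGL_two_of_not_linked (θ i) (θ k) (hcont i) (hcont k) hxz hzx
  have u₄ := isIrreducible_parabolicIndGL_two_of_not_linked (θ k) (θ i) (hcont k) (hcont i) hzx hxz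
  have h3cell := hcell (∏ a : Fin 3, (((![θ i, θ j, θ k] : Fin 3 → (Fˣ →* ℂˣ))) a).comp (Matrix.GeneralLinearGroup.det.comp (Pi.evalMonoidHom (fun a : Fin 3 => GL {i : Fin 3 // (id : Fin 3 → Fin 3) i = a} F) a)))
  -- `D (θ i·ν½) (θ k) ↪ I ![θ i, θ j, θ k]`, proper
  have hη₀ : IsOpen (((θ i * ((unramifiedTwist F (1 / 2) : QuasiChar F).toMonoidHom)).ker : Subgroup Fˣ) : Set Fˣ) := isOpen_ker_mul_of_isOpen (hθ i) isOpen_ker_nuHalf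
  have hex := exists_injective_not_surjective_intertwiningMap (θ i * ((unramifiedTwist F (1 / 2) : QuasiChar F).toMonoidHom)) (θ k) hη₀ (hθ k)
  obtain ⟨Φ, hΦ, hΦ', -⟩ := hex
  have hv : (![(θ i * ((unramifiedTwist F (1 / 2) : QuasiChar F).toMonoidHom)) * ((unramifiedTwist F (1 / 2) : QuasiChar F).toMonoidHom)⁻¹, (θ i * ((unramifiedTwist F (1 / 2) : QuasiChar F).toMonoidHom)) * ((unramifiedTwist F (1 / 2) : QuasiChar F).toMonoidHom), θ k] : Fin 3 → (Fˣ →* ℂˣ)) = ![θ i, θ j, θ k] := by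
    rw [theta_vec_eq, ← hl]
  -- `r_B r₀` is finite-dimensional (through `φ`) and `tch θ` is a weight of `r₀`
  have hIs : (Representation.parabolicIndGL F (id : Fin 3 → Fin 3) ((Representation.trivial ℂ (Π a : Fin 3, GL {i : Fin 3 // (id : Fin 3 → Fin 3) i = a} F) ℂ).twist
      (∏ a : Fin 3, ((θ) a).comp (Matrix.GeneralLinearGroup.det.comp (Pi.evalMonoidHom (fun a : Fin 3 => GL {i : Fin 3 // (id : Fin 3 → Fin 3) i = a} F) a))))).IsSmooth := Representation.isSmooth_smoothInd _ _
  haveI : FiniteDimensional ℂ (restrictUnipotentGL F (id : Fin 3 → Fin 3) (Representation.parabolicIndGL F (id : Fin 3 → Fin 3) ((Representation.trivial ℂ (Π a : Fin 3, GL {i : Fin 3 // (id : Fin 3 → Fin 3) i = a} F) ℂ).twist (∏ a : Fin 3, ((θ) a).comp (Matrix.GeneralLinearGroup.det.comp (Pi.evalMonoidHom (fun a : Fin 3 => GL {i : Fin 3 // (id : Fin 3 → Fin 3) i = a} F) a)))))).Coinvariants :=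
    (finrank_weightSpace_principalSeries_three_tch θ (isOpen_ker_tch _ hθ) (fun _ => 0)).1
  haveI hfd : FiniteDimensional ℂ (restrictUnipotentGL F (id : Fin 3 → Fin 3) r₀.ρ).Coinvariants :=
    Module.Finite.of_injective (jacquetGLMap F (id : Fin 3 → Fin 3) φ).toLinearMap (jacquetGLMap_injective monotone_id hIs φ hφ)
  haveI : Nontrivial r₀.V := IrrClass.nontrivial_of_isIrreducible r₀.ρ
  have hφ0 : φ ≠ 0 := by
    intro h0
    obtain ⟨v, w, hvw⟩ := exists_pair_ne r₀.V
    exact hvw (hφ (by rw [h0]; rfl))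
  have hw : finrank ℂ ↥(⨅ m, Module.End.maxGenEigenspace (normalizedJacquetGL F (id : Fin 3 → Fin 3) r₀.ρ m) (((∏ a : Fin 3, ((θ) a).comp (Matrix.GeneralLinearGroup.det.comp (Pi.evalMonoidHom (fun a : Fin 3 => GL {i : Fin 3 // (id : Fin 3 → Fin 3) i = a} F) a))) m : ℂˣ) : ℂ)) ≠ 0 := finrank_weightSpace_ne_zero_of_intertwiningMap_ne_zero _ r₀.isSmooth _ φ hφ0
  have hθv : θ = ![θ 0, θ 1, θ 2] := funext fun a => by fin_cases a <;> rfl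
  rw [hθv] at hw
  -- transport `Φ` along the vector identity
  revert Φ
  rw [hv]
  intro Φ hΦ hΦ'
  -- the two possible outcomes, packaged in the leaf's RHS shape
  have hA : (finrank ℂ ↥(⨅ m, Module.End.maxGenEigenspace (normalizedJacquetGL F (id : Fin 3 → Fin 3) r₀.ρ m) (((∏ a : Fin 3, (((![θ i, θ j, θ k] : Fin 3 → (Fˣ →* ℂˣ))) a).comp (Matrix.GeneralLinearGroup.det.comp (Pi.evalMonoidHom (fun a : Fin 3 => GL {i : Fin 3 // (id : Fin 3 → Fin 3) i = a} F) a))) m : ℂˣ) : ℂ)) ≠ 0 ∨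
      finrank ℂ ↥(⨅ m, Module.End.maxGenEigenspace (normalizedJacquetGL F (id : Fin 3 → Fin 3) r₀.ρ m) (((∏ a : Fin 3, (((![θ i, θ k, θ j] : Fin 3 → (Fˣ →* ℂˣ))) a).comp (Matrix.GeneralLinearGroup.det.comp (Pi.evalMonoidHom (fun a : Fin 3 => GL {i : Fin 3 // (id : Fin 3 → Fin 3) i = a} F) a))) m : ℂˣ) : ℂ)) ≠ 0 ∨
      finrank ℂ ↥(⨅ m, Module.End.maxGenEigenspace (normalizedJacquetGL F (id : Fin 3 → Fin 3) r₀.ρ m) (((∏ a : Fin 3, (((![θ k, θ i, θ j] : Fin 3 → (Fˣ →* ℂˣ))) a).comp (Matrix.GeneralLinearGroup.det.comp (Pi.evalMonoidHom (fun a : Fin 3 => GL {i : Fin 3 // (id : Fin 3 → Fin 3) i = a} F) a))) m : ℂˣ) : ℂ)) ≠ 0) →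
      ∃ (n₁ n₂ n₃ : ℕ) (a : Fin n₁ → ℤ) (χ : Fin n₁ → ((Π a : Fin 3, GL {i : Fin 3 // (id : Fin 3 → Fin 3) i = a} F) →* ℂˣ))
      (b : Fin n₂ → ℤ) (ψ : Fin n₂ → ((Π t : Bool, GL {i : Fin 3 // (![false, false, true] : Fin 3 → Bool) i = t} F) →* ℂˣ))
      (e : Fin n₃ → ℤ) (η : Fin n₃ → (GL (Fin 3) F →* ℂˣ)),
      (∀ i, IsOpen ((χ i).ker : Set (Π a : Fin 3, GL {i : Fin 3 // (id : Fin 3 → Fin 3) i = a} F))) ∧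
      (∀ j, IsOpen ((ψ j).ker : Set (Π t : Bool, GL {i : Fin 3 // (![false, false, true] : Fin 3 → Bool) i = t} F))) ∧
      (∀ k, IsOpen ((η k).ker : Set (GL (Fin 3) F))) ∧
      ∀ [MeasurableSpace (GL (Fin 3) F)] [BorelSpace (GL (Fin 3) F)] (μ : Measure (GL (Fin 3) F)) [μ.IsHaarMeasure]
        (f : GL (Fin 3) F → ℂ), f ∈ SchwartzBruhat (GL (Fin 3) F) →
        (IrrClass.mk r₀).smoothTrace μ f =
          (∑ i, (a i : ℂ) * (Representation.parabolicIndGL F (id : Fin 3 → Fin 3)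
              ((Representation.trivial ℂ (Π t : Fin 3, GL {i : Fin 3 // (id : Fin 3 → Fin 3) i = t} F) ℂ).twist (χ i))).smoothTrace μ f) +
          (∑ j, (b j : ℂ) * (Representation.parabolicIndGL F (![false, false, true] : Fin 3 → Bool)
              ((Representation.trivial ℂ (Π t : Bool, GL {i : Fin 3 // (![false, false, true] : Fin 3 → Bool) i = t} F) ℂ).twist (ψ j))).smoothTrace μ f) +
          (∑ k, (e k : ℂ) * ((Representation.trivial ℂ (GL (Fin 3) F) ℂ).twist (η k)).smoothTrace μ f) := fun hwA => by
    refine ⟨0, 1, 0, ![], ![], ![1], ![(((θ i * ((unramifiedTwist F (1 / 2) : QuasiChar F).toMonoidHom)).comp (Matrix.GeneralLinearGroup.det.comp (Pi.evalMonoidHom (fun a : Bool => GL {i : Fin 3 // (![false, false, true] : Fin 3 → Bool) i = a} F) false))) * ((θ k).comp (Matrix.GeneralLinearGroup.det.comp (Pi.evalMonoidHom (fun a : Bool => GL {i : Fin 3 // (![false, false, true] : Fin 3 → Bool) i = a} F) true))))], ![], ![],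
      fun a => a.elim0, fun b => ?_, fun c => c.elim0, fun μ _ f _ => ?_⟩
    · fin_cases b
      exact isOpen_ker_psiQ _ _ hη₀ (hθ k)
    · rw [IrrClass.smoothTrace_mk, smoothTrace_eq_of_classA (θ i) (θ j) (θ k) (hθ i) (hθ j) (hθ k) hinj u₁ u₂ u₃ u₄ h3cell _ _ hη₀ (hθ k) Φ hΦ hΦ' r₀ hwA μ f]
      simp only [Finset.univ_eq_empty, Finset.sum_empty, Fin.sum_univ_one, Matrix.cons_val_fin_one, Int.cast_one, one_mul, zero_add, add_zero]
      rfl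
  have hB : (finrank ℂ ↥(⨅ m, Module.End.maxGenEigenspace (normalizedJacquetGL F (id : Fin 3 → Fin 3) r₀.ρ m) (((∏ a : Fin 3, (((![θ j, θ i, θ k] : Fin 3 → (Fˣ →* ℂˣ))) a).comp (Matrix.GeneralLinearGroup.det.comp (Pi.evalMonoidHom (fun a : Fin 3 => GL {i : Fin 3 // (id : Fin 3 → Fin 3) i = a} F) a))) m : ℂˣ) : ℂ)) ≠ 0 ∨
      finrank ℂ ↥(⨅ m, Module.End.maxGenEigenspace (normalizedJacquetGL F (id : Fin 3 → Fin 3) r₀.ρ m) (((∏ a : Fin 3, (((![θ j, θ k, θ i] : Fin 3 → (Fˣ →* ℂˣ))) a).comp (Matrix.GeneralLinearGroup.det.comp (Pi.evalMonoidHom (fun a : Fin 3 => GL {i : Fin 3 // (id : Fin 3 → Fin 3) i = a} F) a))) m : ℂˣ) : ℂ)) ≠ 0 ∨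
      finrank ℂ ↥(⨅ m, Module.End.maxGenEigenspace (normalizedJacquetGL F (id : Fin 3 → Fin 3) r₀.ρ m) (((∏ a : Fin 3, (((![θ k, θ j, θ i] : Fin 3 → (Fˣ →* ℂˣ))) a).comp (Matrix.GeneralLinearGroup.det.comp (Pi.evalMonoidHom (fun a : Fin 3 => GL {i : Fin 3 // (id : Fin 3 → Fin 3) i = a} F) a))) m : ℂˣ) : ℂ)) ≠ 0) →
      ∃ (n₁ n₂ n₃ : ℕ) (a : Fin n₁ → ℤ) (χ : Fin n₁ → ((Π a : Fin 3, GL {i : Fin 3 // (id : Fin 3 → Fin 3) i = a} F) →* ℂˣ))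
      (b : Fin n₂ → ℤ) (ψ : Fin n₂ → ((Π t : Bool, GL {i : Fin 3 // (![false, false, true] : Fin 3 → Bool) i = t} F) →* ℂˣ))
      (e : Fin n₃ → ℤ) (η : Fin n₃ → (GL (Fin 3) F →* ℂˣ)),
      (∀ i, IsOpen ((χ i).ker : Set (Π a : Fin 3, GL {i : Fin 3 // (id : Fin 3 → Fin 3) i = a} F))) ∧
      (∀ j, IsOpen ((ψ j).ker : Set (Π t : Bool, GL {i : Fin 3 // (![false, false, true] : Fin 3 → Bool) i = t} F))) ∧
      (∀ k, IsOpen ((η k).ker : Set (GL (Fin 3) F))) ∧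
      ∀ [MeasurableSpace (GL (Fin 3) F)] [BorelSpace (GL (Fin 3) F)] (μ : Measure (GL (Fin 3) F)) [μ.IsHaarMeasure]
        (f : GL (Fin 3) F → ℂ), f ∈ SchwartzBruhat (GL (Fin 3) F) →
        (IrrClass.mk r₀).smoothTrace μ f =
          (∑ i, (a i : ℂ) * (Representation.parabolicIndGL F (id : Fin 3 → Fin 3)
              ((Representation.trivial ℂ (Π t : Fin 3, GL {i : Fin 3 // (id : Fin 3 → Fin 3) i = t} F) ℂ).twist (χ i))).smoothTrace μ f) +
          (∑ j, (b j : ℂ) * (Representation.parabolicIndGL F (![false, false, true] : Fin 3 → Bool)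
              ((Representation.trivial ℂ (Π t : Bool, GL {i : Fin 3 // (![false, false, true] : Fin 3 → Bool) i = t} F) ℂ).twist (ψ j))).smoothTrace μ f) +
          (∑ k, (e k : ℂ) * ((Representation.trivial ℂ (GL (Fin 3) F) ℂ).twist (η k)).smoothTrace μ f) := fun hwB => by
    refine ⟨1, 1, 0, ![1], ![(∏ a : Fin 3, (((![θ i, θ j, θ k] : Fin 3 → (Fˣ →* ℂˣ))) a).comp (Matrix.GeneralLinearGroup.det.comp (Pi.evalMonoidHom (fun a : Fin 3 => GL {i : Fin 3 // (id : Fin 3 → Fin 3) i = a} F) a)))], ![-1], ![(((θ i * ((unramifiedTwist F (1 / 2) : QuasiChar F).toMonoidHom)).comp (Matrix.GeneralLinearGroup.det.comp (Pi.evalMonoidHom (fun a : Bool => GL {i : Fin 3 // (![false, false, true] : Fin 3 → Bool) i = a} F) false))) * ((θ k).comp (Matrix.GeneralLinearGroup.det.comp (Pi.evalMonoidHom (fun a : Bool => GL {i : Fin 3 // (![false, false, true] : Fin 3 → Bool) i = a} F) true))))], ![], ![],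
      fun a => ?_, fun b => ?_, fun c => c.elim0, fun μ _ f _ => ?_⟩
    · fin_cases a
      exact isOpen_ker_tch _ (fun a => by
        fin_cases a
        · exact hθ i
        · exact hθ j
        · exact hθ k)
    · fin_cases b
      exact isOpen_ker_psiQ _ _ hη₀ (hθ k)
    · rw [IrrClass.smoothTrace_mk, smoothTrace_eq_of_classB (θ i) (θ j) (θ k) (hθ i) (hθ j) (hθ k) hinj u₁ u₂ u₃ u₄ h3cell _ _ hη₀ (hθ k) Φ hΦ hΦ' r₀ hwB μ f]
      simp only [Finset.univ_eq_empty, Finset.sum_empty, Fin.sum_univ_one, Matrix.cons_val_fin_one, Int.cast_one, Int.cast_neg, one_mul, neg_mul,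
        add_zero, sub_eq_add_neg]
      rfl
  -- the position pattern `(i, j, k)` decides the class of `tch θ`
  fin_cases i <;> fin_cases j <;> fin_cases k
  all_goals (first | exact absurd rfl hij | exact absurd rfl hik | exact absurd rfl hjk | skip)
  · exact hA (Or.inl hw)
  · exact hA (Or.inr (Or.inl hw))
  · exact hB (Or.inl hw)
  · exact hA (Or.inr (Or.inr hw))
  · exact hB (Or.inr (Or.inl hw))
  · exact hB (Or.inr (Or.inr hw))

end Summit.HodgeConjecture.HodgeConjecture.Cruxes.H413.K2E3GL3OneLinkGenericStandardSpan

end
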